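import Literature.Combinatorics.Enumerative.SetExponential
import HarnessLib

/-!
# Route `PrintCf2`, crux stmt-BirchSwinnertonDyer-20509 `RamifiedOffTYZOfFacts` — DEFINITIONS for the subset-convolution calculus of the even Ω-identity
# (cell `bsd-print-cf2`, LEAD of 20509 g14, line `offtyz-v7`, cycle 15; route-posited objects, DEFINITIONS ONLY — nothing asserted)

Three pieces of finite-set bookkeeping vocabulary used by the forest-calculus proof of LEAD g13's research statement `EvenOmegaMatrixIdentity`
(crux workfiles `Cruxes/RamifiedOffTYZOfFacts/Lines/offtyz_v7_EvenOmega.lean`, `Lines/offtyz_v7_EvenOmegaProof.md` §1): rows (iii)/(iv) of that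
identity are equalities between iterated SUBSET CONVOLUTIONS of the tree's forest block weights (`qwt`, `fwt`, `setExp` of
`Literature/LinearAlgebra/Matrix/BipartiteForest*.lean`, `Literature/Combinatorics/Enumerative/SetExponential.lean`) decorated by POINTINGS.
Naming them makes the Leibniz rule, associativity and the exponential formula usable as rewrite rules (the algebra is the sibling proof file
`…QFormConvolution.lean`).  Nothing is asserted here.  BSD is not proved by any of this.

* `sconv f g X = Σ_{A ⊆ X} f(A)·g(X∖A)` — subset convolution (product of exponential generating functions);
* `spoint v f X = (Σ_{i∈X} v i)·f(X)` — pointing a weight by an additive statistic;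
* `sdelta X = [X = ∅]` — the convolution unit.

References: [cite: Stanley1999EC2, Cor. 5.1.6 (the exponential formula; elementary finite form: products, pointing)].
-/

namespace Summit.BirchSwinnertonDyer.PrintCf2.QFormForest

open Finset

variable {V : Type*} [DecidableEq V]

/-- **Subset convolution** `(f ⋆ g)(X) = Σ_{A ⊆ X} f(A) · g(X ∖ A)` of two weights on finite sets.
[cite: Stanley1999EC2, Cor. 5.1.6 (exponential formula: product of exponential generating functions = convolution)] -/
def sconv (f g : Finset V → ZMod 2) (X : Finset V) : ZMod 2 := ∑ A ∈ X.powerset, f A * g (X \ A)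

omit [DecidableEq V] in
/-- **Pointing** a weight by an additive statistic: `(p_v f)(X) = (Σ_{i∈X} v i) · f(X)`. [cite: Stanley1999EC2, Cor. 5.1.6 (pointing)] -/
def spoint (v : V → ZMod 2) (f : Finset V → ZMod 2) (X : Finset V) : ZMod 2 := (∑ i ∈ X, v i) * f X

/-- The convolution unit `δ(X) = [X = ∅]`. [cite: Stanley1999EC2, Cor. 5.1.6] -/
def sdelta (X : Finset V) : ZMod 2 := if X = ∅ then 1 else 0

/-- Unfolding `sconv`. [cite: Stanley1999EC2, Cor. 5.1.6] -/
theorem sconv_apply (f g : Finset V → ZMod 2) (X : Finset V) : sconv f g X = ∑ A ∈ X.powerset, f A * g (X \ A) := rfl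

omit [DecidableEq V] in
/-- Unfolding `spoint`. [cite: Stanley1999EC2, Cor. 5.1.6] -/
theorem spoint_apply (v : V → ZMod 2) (f : Finset V → ZMod 2) (X : Finset V) : spoint v f X = (∑ i ∈ X, v i) * f X := rfl

/-- Unfolding `sdelta`. [cite: Stanley1999EC2, Cor. 5.1.6] -/
theorem sdelta_apply (X : Finset V) : sdelta X = if X = ∅ then 1 else 0 := rfl

end Summit.BirchSwinnertonDyer.PrintCf2.QFormForest
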